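import Summits.ValiantsHypothesis.ValiantsHypothesis.Theorems.LacunarySymmetroidMatrixDescartesDoorA26WallBubblingWallExitWiring

/-!
# Wall bubbling for `DoorA26` — WALL EXIT, TWO WEYL PAIRS, shape (c1) `e₀ + e₀' = e_k + e_l`: the four-node moment recurrence kills the fifth slot

LINE / STUBS.  Crux `Theses.LacunarySymmetroid.DoorA26` (stmt-ValiantsHypothesis-19979; OPEN, typed, never asserted), line
`Cruxes/DoorA26/Lines/wall_bubbling.lean` (val-idea-15); serves `Stmt.weylFaces_wall`, EXIT side, the sub-stratum with TWO Weyl pairs `{i,j}` (value `e₀`),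
`{i',j'}` (value `e₀'`), singles `k, l`, and the value relation (c1) `e₀ + e₀' = e_k + e_l` (`…WallExitMoments` header listed (c1)–(c3) as NAMED OPEN; this file
COVERS (c1), per cluster; (c2)/(c3) `e₀ + e_k = e₀' + e_l` stay OPEN).  The merged class is `V = {ii', ij', ji', jj'} ∪ {kl}`: FIVE member exponents, so up to
five slots, one more than the generic two-pair count of the class `e₀ + e₀'` (four).  The fifth slot dies (def-free, member currency as in #18):

* `node_pow_four` — Vieta at a node: if `x` is one of four reals `λ₁..λ₄` then `x⁴ = σ₁x³ − σ₂x² + σ₃x − σ₄` (elementary symmetric `σ`);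
* `moment_four_recurrence_bound` — for the four Weyl-cross members (each its own node, `|ε| ≤ w ≤ 1`): `|M'₄| ≤ 4w|M'₃| + 6w²|M'₂| + 4w³|M'₁| + w⁴|M'₀|`
  — NO Vandermonde conditioning, no gap hypothesis;
* **`wallWiring_caseC1`** — if the cluster scale `μ` dominates the two triple class sums, the four doubleton sums `a(x,k)+a(y,k)`, `a(x,l)+a(y,l)` of both pairs,
  the singletons `kk, ll`, the merged class sum `A + a(k,l)` (`A` = the four cross members) and the merged class's moments `M₁, M₂, M₃`, and `|ε| ≤ w → 0`,
  then `M₄(V)/μ → 0`: `relative_dSieve` on the merged Gram with BOTH pairs merged (`realisable_classGram`) gives `A = O(μ)` and `a(k,l) = O(μ)`, and the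
  recurrence bounds the cross members' fourth moment by `O(w·μ)`.  So `V` keeps `≤ 4` slots, the per-cluster limit object has `≤ 20` slots, count `≤ 19`
  (`…ConfluentCount`) — door-free PER CLUSTER; the shared middle incl. the (W-split) multi-scale gap is untouched (idea-15 19:28Z).

Nothing in this file bears on (W)/(M)/(R) themselves, on `DoorA26`, on `MatrixDescartes` (stmt-ValiantsHypothesis-18050) or on `VP ≠ VNP`; registers unchanged.
Seat val-sym-door-p2 g12 (W1 #19), `--supports stmt-ValiantsHypothesis-19979 --as helper`. [folklore] Vieta / Newton recurrence. [this work] bookkeeping.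
-/

-- `Summit.ValiantsHypothesis.ValiantsHypothesis.…` repeats a component by the D-0017 layout
-- (single-conjunct summit), which the `dupNamespace` linter flags; the name is mandated.
set_option linter.dupNamespace false

namespace Summit.ValiantsHypothesis.ValiantsHypothesis.Theorems.LacunarySymmetroidMatrixDescartes.WallBubbling.SecondOrder

open Finset Filter Topology
open scoped BigOperators
open Summit.ValiantsHypothesis.ValiantsHypothesis.Theorems.LacunarySymmetroidMatrixDescartes.WallBubbling.Bubbling

/-! ## §1 The four-node recurrence -/

/-- **Vieta at a node.**  If `x ∈ {λ₁, λ₂, λ₃, λ₄}` then `x⁴ = σ₁ x³ − σ₂ x² + σ₃ x − σ₄`. [folklore] -/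
theorem node_pow_four (x l₁ l₂ l₃ l₄ : ℝ) (hx : x = l₁ ∨ x = l₂ ∨ x = l₃ ∨ x = l₄) :
    x ^ 4 = (l₁ + l₂ + l₃ + l₄) * x ^ 3 - (l₁ * l₂ + l₁ * l₃ + l₁ * l₄ + l₂ * l₃ + l₂ * l₄ + l₃ * l₄) * x ^ 2
      + (l₁ * l₂ * l₃ + l₁ * l₂ * l₄ + l₁ * l₃ * l₄ + l₂ * l₃ * l₄) * x - l₁ * l₂ * l₃ * l₄ := by
  have hprod : (x - l₁) * (x - l₂) * (x - l₃) * (x - l₄) = 0 := by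
    rcases hx with rfl | rfl | rfl | rfl <;> ring
  have : x ^ 4 - ((l₁ + l₂ + l₃ + l₄) * x ^ 3 - (l₁ * l₂ + l₁ * l₃ + l₁ * l₄ + l₂ * l₃ + l₂ * l₄ + l₃ * l₄) * x ^ 2
      + (l₁ * l₂ * l₃ + l₁ * l₂ * l₄ + l₁ * l₃ * l₄ + l₂ * l₃ * l₄) * x - l₁ * l₂ * l₃ * l₄)
      = (x - l₁) * (x - l₂) * (x - l₃) * (x - l₄) := by ring
  linarith [this, hprod]

/-- **Four-node moment recurrence bound.**  Four members with coefficients `b₁..b₄` sitting at their own nodes `λ₁..λ₄` (`|λ_a| ≤ w`): the fourth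
moment is controlled by the lower ones, `|M₄| ≤ 4w|M₃| + 6w²|M₂| + 4w³|M₁| + w⁴|M₀|`, `M_m = Σ_a b_a λ_a^m`. [folklore] -/
theorem moment_four_recurrence_bound (b₁ b₂ b₃ b₄ l₁ l₂ l₃ l₄ w : ℝ)
    (h₁ : |l₁| ≤ w) (h₂ : |l₂| ≤ w) (h₃ : |l₃| ≤ w) (h₄ : |l₄| ≤ w) :
    |b₁ * l₁ ^ 4 + b₂ * l₂ ^ 4 + b₃ * l₃ ^ 4 + b₄ * l₄ ^ 4|
      ≤ 4 * w * |b₁ * l₁ ^ 3 + b₂ * l₂ ^ 3 + b₃ * l₃ ^ 3 + b₄ * l₄ ^ 3|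
        + 6 * w ^ 2 * |b₁ * l₁ ^ 2 + b₂ * l₂ ^ 2 + b₃ * l₃ ^ 2 + b₄ * l₄ ^ 2|
        + 4 * w ^ 3 * |b₁ * l₁ + b₂ * l₂ + b₃ * l₃ + b₄ * l₄| + w ^ 4 * |b₁ + b₂ + b₃ + b₄| := by
  have hw0 : 0 ≤ w := (abs_nonneg _).trans h₁
  set s₁ := l₁ + l₂ + l₃ + l₄ with hs₁
  set s₂ := l₁ * l₂ + l₁ * l₃ + l₁ * l₄ + l₂ * l₃ + l₂ * l₄ + l₃ * l₄ with hs₂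
  set s₃ := l₁ * l₂ * l₃ + l₁ * l₂ * l₄ + l₁ * l₃ * l₄ + l₂ * l₃ * l₄ with hs₃
  set s₄ := l₁ * l₂ * l₃ * l₄ with hs₄
  set M₀ := b₁ + b₂ + b₃ + b₄
  set M₁ := b₁ * l₁ + b₂ * l₂ + b₃ * l₃ + b₄ * l₄
  set M₂ := b₁ * l₁ ^ 2 + b₂ * l₂ ^ 2 + b₃ * l₃ ^ 2 + b₄ * l₄ ^ 2
  set M₃ := b₁ * l₁ ^ 3 + b₂ * l₂ ^ 3 + b₃ * l₃ ^ 3 + b₄ * l₄ ^ 3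
  -- the recurrence
  have hrec : b₁ * l₁ ^ 4 + b₂ * l₂ ^ 4 + b₃ * l₃ ^ 4 + b₄ * l₄ ^ 4 = s₁ * M₃ - s₂ * M₂ + s₃ * M₁ - s₄ * M₀ := by
    have e₁ := node_pow_four l₁ l₁ l₂ l₃ l₄ (Or.inl rfl)
    have e₂ := node_pow_four l₂ l₁ l₂ l₃ l₄ (Or.inr (Or.inl rfl))
    have e₃ := node_pow_four l₃ l₁ l₂ l₃ l₄ (Or.inr (Or.inr (Or.inl rfl)))
    have e₄ := node_pow_four l₄ l₁ l₂ l₃ l₄ (Or.inr (Or.inr (Or.inr rfl)))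
    rw [e₁, e₂, e₃, e₄]
    simp only [hs₁, hs₂, hs₃, hs₄, M₀, M₁, M₂, M₃]
    ring
  -- bounds on the symmetric functions
  have a₁ := abs_le.mp h₁; have a₂ := abs_le.mp h₂; have a₃ := abs_le.mp h₃; have a₄ := abs_le.mp h₄
  have hb₁ : |s₁| ≤ 4 * w := by
    rw [hs₁]
    calc |l₁ + l₂ + l₃ + l₄| ≤ |l₁| + |l₂| + |l₃| + |l₄| := by
          have := abs_add_le (l₁ + l₂ + l₃) l₄; have := abs_add_le (l₁ + l₂) l₃; have := abs_add_le l₁ l₂; linarith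
      _ ≤ 4 * w := by linarith
  have hprod2 : ∀ x y : ℝ, |x| ≤ w → |y| ≤ w → |x * y| ≤ w ^ 2 := by
    intro x y hx hy; rw [abs_mul, sq]; exact mul_le_mul hx hy (abs_nonneg _) hw0
  have hprod3 : ∀ x y z : ℝ, |x| ≤ w → |y| ≤ w → |z| ≤ w → |x * y * z| ≤ w ^ 3 := by
    intro x y z hx hy hz
    rw [abs_mul, pow_succ]
    exact mul_le_mul (hprod2 x y hx hy) hz (abs_nonneg _) (pow_nonneg hw0 _)
  have hb₂ : |s₂| ≤ 6 * w ^ 2 := by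
    rw [hs₂]
    have t1 := hprod2 _ _ h₁ h₂; have t2 := hprod2 _ _ h₁ h₃; have t3 := hprod2 _ _ h₁ h₄
    have t4 := hprod2 _ _ h₂ h₃; have t5 := hprod2 _ _ h₂ h₄; have t6 := hprod2 _ _ h₃ h₄
    calc |l₁ * l₂ + l₁ * l₃ + l₁ * l₄ + l₂ * l₃ + l₂ * l₄ + l₃ * l₄|
        ≤ |l₁ * l₂| + |l₁ * l₃| + |l₁ * l₄| + |l₂ * l₃| + |l₂ * l₄| + |l₃ * l₄| := by
          have := abs_add_le (l₁ * l₂ + l₁ * l₃ + l₁ * l₄ + l₂ * l₃ + l₂ * l₄) (l₃ * l₄)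
          have := abs_add_le (l₁ * l₂ + l₁ * l₃ + l₁ * l₄ + l₂ * l₃) (l₂ * l₄)
          have := abs_add_le (l₁ * l₂ + l₁ * l₃ + l₁ * l₄) (l₂ * l₃)
          have := abs_add_le (l₁ * l₂ + l₁ * l₃) (l₁ * l₄)
          have := abs_add_le (l₁ * l₂) (l₁ * l₃)
          linarith
      _ ≤ 6 * w ^ 2 := by linarith
  have hb₃ : |s₃| ≤ 4 * w ^ 3 := by
    rw [hs₃]
    have t1 := hprod3 _ _ _ h₁ h₂ h₃; have t2 := hprod3 _ _ _ h₁ h₂ h₄; have t3 := hprod3 _ _ _ h₁ h₃ h₄; have t4 := hprod3 _ _ _ h₂ h₃ h₄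
    calc |l₁ * l₂ * l₃ + l₁ * l₂ * l₄ + l₁ * l₃ * l₄ + l₂ * l₃ * l₄|
        ≤ |l₁ * l₂ * l₃| + |l₁ * l₂ * l₄| + |l₁ * l₃ * l₄| + |l₂ * l₃ * l₄| := by
          have := abs_add_le (l₁ * l₂ * l₃ + l₁ * l₂ * l₄ + l₁ * l₃ * l₄) (l₂ * l₃ * l₄)
          have := abs_add_le (l₁ * l₂ * l₃ + l₁ * l₂ * l₄) (l₁ * l₃ * l₄)
          have := abs_add_le (l₁ * l₂ * l₃) (l₁ * l₂ * l₄)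
          linarith
      _ ≤ 4 * w ^ 3 := by linarith
  have hb₄ : |s₄| ≤ w ^ 4 := by
    rw [hs₄, abs_mul, show w ^ 4 = w ^ 3 * w by ring]
    exact mul_le_mul (hprod3 _ _ _ h₁ h₂ h₃) h₄ (abs_nonneg _) (pow_nonneg hw0 _)
  rw [hrec]
  have e1 : |s₁ * M₃| ≤ 4 * w * |M₃| := by rw [abs_mul]; exact mul_le_mul_of_nonneg_right hb₁ (abs_nonneg _)
  have e2 : |s₂ * M₂| ≤ 6 * w ^ 2 * |M₂| := by rw [abs_mul]; exact mul_le_mul_of_nonneg_right hb₂ (abs_nonneg _)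
  have e3 : |s₃ * M₁| ≤ 4 * w ^ 3 * |M₁| := by rw [abs_mul]; exact mul_le_mul_of_nonneg_right hb₃ (abs_nonneg _)
  have e4 : |s₄ * M₀| ≤ w ^ 4 * |M₀| := by rw [abs_mul]; exact mul_le_mul_of_nonneg_right hb₄ (abs_nonneg _)
  have := abs_sub (s₁ * M₃ - s₂ * M₂ + s₃ * M₁) (s₄ * M₀)
  have := abs_add_le (s₁ * M₃ - s₂ * M₂) (s₃ * M₁)
  have := abs_sub (s₁ * M₃) (s₂ * M₂)
  linarith

/-! ## §2 Shape (c1): `e₀ + e₀' = e_k + e_l` -/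

/-- **WIRING, two Weyl pairs, shape (c1).**  Pairs `{i,j}`, `{i',j'}`, singles `k, l` (`i, i', k, l` distinct, `i ≠ j`, `i' ≠ j'`); the merged class is the four
Weyl-cross members `(i,i'),(i,j'),(j,i'),(j,j')` together with `(k,l)` (ordered-pair halves).  If the scale `μ` dominates the listed class sums and the merged
class's moments `M₁, M₂, M₃`, and `|ε| ≤ w → 0`, then `M₄/μ → 0` — the merged class keeps at most the four slots of the generic two-pair count.
[this work] -/
theorem wallWiring_caseC1 (a : ℕ → Fin 6 × Fin 6 → ℝ) (ha : ∀ ν, Realisable (Matrix.of fun x y => a ν (x, y)))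
    (i j i' j' k l : Fin 6) (hij : i ≠ j) (hi'j' : i' ≠ j') (hii' : i ≠ i') (hik : i ≠ k) (hil : i ≠ l) (hi'k : i' ≠ k) (hi'l : i' ≠ l)
    (hkl : k ≠ l)
    (μ : ℕ → ℝ) (hμ : ∀ ν, 0 < μ ν)
    (htriple : ∀ ν, |a ν (i, i) + a ν (i, j) + a ν (j, i) + a ν (j, j)| ≤ μ ν ∧ |a ν (i', i') + a ν (i', j') + a ν (j', i') + a ν (j', j')| ≤ μ ν)
    (hdoub : ∀ ν, |a ν (i, k) + a ν (j, k)| ≤ μ ν ∧ |a ν (i, l) + a ν (j, l)| ≤ μ ν ∧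
      |a ν (i', k) + a ν (j', k)| ≤ μ ν ∧ |a ν (i', l) + a ν (j', l)| ≤ μ ν)
    (hdiag : ∀ ν, |a ν (k, k)| ≤ μ ν ∧ |a ν (l, l)| ≤ μ ν)
    (hsum0 : ∀ ν, |a ν (i, i') + a ν (i, j') + a ν (j, i') + a ν (j, j') + a ν (k, l)| ≤ μ ν)
    (ε : ℕ → Fin 6 × Fin 6 → ℝ) (w : ℕ → ℝ) (hε : ∀ ν p, |ε ν p| ≤ w ν) (hwlim : Tendsto w atTop (𝓝 0))
    (hM : ∀ ν, ∀ m ∈ ({1, 2, 3} : Finset ℕ),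
      |a ν (i, i') * ε ν (i, i') ^ m + a ν (i, j') * ε ν (i, j') ^ m + a ν (j, i') * ε ν (j, i') ^ m + a ν (j, j') * ε ν (j, j') ^ m
        + a ν (k, l) * ε ν (k, l) ^ m| ≤ μ ν) :
    Tendsto (fun ν => (a ν (i, i') * ε ν (i, i') ^ 4 + a ν (i, j') * ε ν (i, j') ^ 4 + a ν (j, i') * ε ν (j, i') ^ 4
      + a ν (j, j') * ε ν (j, j') ^ 4 + a ν (k, l) * ε ν (k, l) ^ 4) / μ ν) atTop (𝓝 0) := by
  classical
  -- merged Gram: both pairs merged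
  let cls : Fin 6 → Finset (Fin 6) := fun x => if x = i then {i, j} else if x = i' then {i', j'} else {x}
  let G' : ℕ → Matrix (Fin 6) (Fin 6) ℝ := fun ν => Matrix.of fun y z => ∑ p ∈ cls y, ∑ q ∈ cls z, (Matrix.of fun x y => a ν (x, y)) p q
  have hG' : ∀ ν, Realisable (G' ν) := fun ν => realisable_classGram (ha ν) cls
  have hi'i : i' ≠ i := fun h => hii' h.symm
  have cls_i : cls i = {i, j} := by simp [cls]
  have cls_i' : cls i' = {i', j'} := by simp [cls, hi'i]
  have hki : k ≠ i := fun h => hik h.symm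
  have hli : l ≠ i := fun h => hil h.symm
  have hki' : k ≠ i' := fun h => hi'k h.symm
  have hli' : l ≠ i' := fun h => hi'l h.symm
  have cls_k : cls k = {k} := by simp [cls, hki, hki']
  have cls_l : cls l = {l} := by simp [cls, hli, hli']
  -- entries on the block `{i, i', k, l}`
  have e_ii : ∀ ν, G' ν i i = a ν (i, i) + a ν (i, j) + a ν (j, i) + a ν (j, j) := by
    intro ν; simp only [G', Matrix.of_apply, cls_i]; rw [Finset.sum_pair hij, Finset.sum_pair hij, Finset.sum_pair hij]; ring
  have e_i'i' : ∀ ν, G' ν i' i' = a ν (i', i') + a ν (i', j') + a ν (j', i') + a ν (j', j') := by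
    intro ν; simp only [G', Matrix.of_apply, cls_i']; rw [Finset.sum_pair hi'j', Finset.sum_pair hi'j', Finset.sum_pair hi'j']; ring
  have e_ii' : ∀ ν, G' ν i i' = a ν (i, i') + a ν (i, j') + a ν (j, i') + a ν (j, j') := by
    intro ν; simp only [G', Matrix.of_apply, cls_i, cls_i']; rw [Finset.sum_pair hij, Finset.sum_pair hi'j', Finset.sum_pair hi'j']; ring
  have e_kk : ∀ ν, G' ν k k = a ν (k, k) := by intro ν; simp only [G', Matrix.of_apply, cls_k, Finset.sum_singleton]
  have e_ll : ∀ ν, G' ν l l = a ν (l, l) := by intro ν; simp only [G', Matrix.of_apply, cls_l, Finset.sum_singleton]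
  have e_kl : ∀ ν, G' ν k l = a ν (k, l) := by intro ν; simp only [G', Matrix.of_apply, cls_k, cls_l, Finset.sum_singleton]
  have e_ik : ∀ ν, G' ν i k = a ν (i, k) + a ν (j, k) := by
    intro ν; simp only [G', Matrix.of_apply, cls_i, cls_k, Finset.sum_singleton]; rw [Finset.sum_pair hij]
  have e_il : ∀ ν, G' ν i l = a ν (i, l) + a ν (j, l) := by
    intro ν; simp only [G', Matrix.of_apply, cls_i, cls_l, Finset.sum_singleton]; rw [Finset.sum_pair hij]
  have e_i'k : ∀ ν, G' ν i' k = a ν (i', k) + a ν (j', k) := by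
    intro ν; simp only [G', Matrix.of_apply, cls_i', cls_k, Finset.sum_singleton]; rw [Finset.sum_pair hi'j']
  have e_i'l : ∀ ν, G' ν i' l = a ν (i', l) + a ν (j', l) := by
    intro ν; simp only [G', Matrix.of_apply, cls_i', cls_l, Finset.sum_singleton]; rw [Finset.sum_pair hi'j']
  have e_ki : ∀ ν, G' ν k i = a ν (k, i) + a ν (k, j) := by
    intro ν; simp only [G', Matrix.of_apply, cls_i, cls_k, Finset.sum_singleton]; rw [Finset.sum_pair hij]
  have e_ki' : ∀ ν, G' ν k i' = a ν (k, i') + a ν (k, j') := by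
    intro ν; simp only [G', Matrix.of_apply, cls_i', cls_k, Finset.sum_singleton]; rw [Finset.sum_pair hi'j']
  have e_li : ∀ ν, G' ν l i = a ν (l, i) + a ν (l, j) := by
    intro ν; simp only [G', Matrix.of_apply, cls_i, cls_l, Finset.sum_singleton]; rw [Finset.sum_pair hij]
  have e_li' : ∀ ν, G' ν l i' = a ν (l, i') + a ν (l, j') := by
    intro ν; simp only [G', Matrix.of_apply, cls_i', cls_l, Finset.sum_singleton]; rw [Finset.sum_pair hi'j']
  -- relative sieve, merged pair `{(i,i'), (k,l)}`: bounds `A`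
  obtain ⟨C', hC'⟩ := relative_dSieve G' hG' i i' k l hii' hik hil hi'k hi'l hkl μ hμ 1
    (fun ν => by rw [e_ii, e_i'i', e_kk, e_ll, one_mul]; exact ⟨(htriple ν).1, (htriple ν).2, hdiag ν⟩)
    (fun ν => by rw [e_ik, e_il, e_i'k, e_i'l, one_mul]; exact hdoub ν)
    (fun ν => by rw [e_ii', e_kl, one_mul]; exact hsum0 ν)
  -- relative sieve, roles exchanged: bounds `a(k,l)`
  obtain ⟨C'', hC''⟩ := relative_dSieve G' hG' k l i i' hkl hki hki' hli hli' hii' μ hμ 1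
    (fun ν => by rw [e_ii, e_i'i', e_kk, e_ll, one_mul]; exact ⟨(hdiag ν).1, (hdiag ν).2, htriple ν⟩)
    (fun ν => by
      rw [e_ki, e_ki', e_li, e_li', one_mul]
      obtain ⟨h1, h2, h3, h4⟩ := hdoub ν
      rw [stage_symm (ha ν) k i, stage_symm (ha ν) k j, stage_symm (ha ν) k i', stage_symm (ha ν) k j',
        stage_symm (ha ν) l i, stage_symm (ha ν) l j, stage_symm (ha ν) l i', stage_symm (ha ν) l j']
      exact ⟨h1, h3, h2, h4⟩)
    (fun ν => by
      rw [e_kl, e_ii', one_mul]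
      have := hsum0 ν
      have e : a ν (k, l) + (a ν (i, i') + a ν (i, j') + a ν (j, i') + a ν (j, j'))
          = a ν (i, i') + a ν (i, j') + a ν (j, i') + a ν (j, j') + a ν (k, l) := by ring
      rwa [e])
  have hA : ∀ ν, |a ν (i, i') + a ν (i, j') + a ν (j, i') + a ν (j, j')| ≤ C' * μ ν := fun ν => by
    have := hC' ν; rwa [e_ii'] at this
  have hKL : ∀ ν, |a ν (k, l)| ≤ C'' * μ ν := fun ν => by
    have := hC'' ν; rwa [e_kl] at this
  have hC'0 : 0 ≤ C' := by
    have h := (abs_nonneg _).trans (hA 0)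
    by_contra hc
    push Not at hc
    have := mul_neg_of_neg_of_pos hc (hμ 0)
    linarith
  have hC''0 : 0 ≤ C'' := by
    have h := (abs_nonneg _).trans (hKL 0)
    by_contra hc
    push Not at hc
    have := mul_neg_of_neg_of_pos hc (hμ 0)
    linarith
  -- eventually `w ≤ 1`
  have hw0 : ∀ ν, 0 ≤ w ν := fun ν => (abs_nonneg _).trans (hε ν (i, i'))
  have hw1 : ∀ᶠ ν in atTop, w ν ≤ 1 := (hwlim.eventually (Iic_mem_nhds zero_lt_one)).mono fun ν h => h
  -- the bound: `|M₄| ≤ (15 (1 + C') + 2 C'') w μ` once `w ≤ 1`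
  have hbound : ∀ᶠ ν in atTop, |(a ν (i, i') * ε ν (i, i') ^ 4 + a ν (i, j') * ε ν (i, j') ^ 4 + a ν (j, i') * ε ν (j, i') ^ 4
      + a ν (j, j') * ε ν (j, j') ^ 4 + a ν (k, l) * ε ν (k, l) ^ 4) / μ ν| ≤ (15 * (1 + C'' + C') + C'') * w ν := by
    filter_upwards [hw1] with ν hν
    have hμ' := hμ ν
    rw [abs_div, abs_of_pos hμ', div_le_iff₀ hμ']
    -- the cross part
    have hrec := moment_four_recurrence_bound (a ν (i, i')) (a ν (i, j')) (a ν (j, i')) (a ν (j, j'))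
      (ε ν (i, i')) (ε ν (i, j')) (ε ν (j, i')) (ε ν (j, j')) (w ν) (hε ν _) (hε ν _) (hε ν _) (hε ν _)
    -- lower cross moments are `≤ (1 + C'') μ`: remove the `kl` member from `hM`
    have hkl_m : ∀ m : ℕ, 1 ≤ m → |a ν (k, l) * ε ν (k, l) ^ m| ≤ C'' * μ ν := by
      intro m hm
      rw [abs_mul, abs_pow]
      have h1 : |ε ν (k, l)| ^ m ≤ 1 := pow_le_one₀ (abs_nonneg _) ((hε ν _).trans hν)
      calc |a ν (k, l)| * |ε ν (k, l)| ^ m ≤ C'' * μ ν * 1 := mul_le_mul (hKL ν) h1 (pow_nonneg (abs_nonneg _) _) (mul_nonneg hC''0 hμ'.le)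
        _ = C'' * μ ν := mul_one _
    have hlow : ∀ m ∈ ({1, 2, 3} : Finset ℕ),
        |a ν (i, i') * ε ν (i, i') ^ m + a ν (i, j') * ε ν (i, j') ^ m + a ν (j, i') * ε ν (j, i') ^ m + a ν (j, j') * ε ν (j, j') ^ m|
          ≤ (1 + C'') * μ ν := by
      intro m hm
      have h1 := hM ν m hm
      have hm1 : 1 ≤ m := by simp only [Finset.mem_insert, Finset.mem_singleton] at hm; omega
      have h2 := hkl_m m hm1
      have := abs_sub (a ν (i, i') * ε ν (i, i') ^ m + a ν (i, j') * ε ν (i, j') ^ m + a ν (j, i') * ε ν (j, i') ^ m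
        + a ν (j, j') * ε ν (j, j') ^ m + a ν (k, l) * ε ν (k, l) ^ m) (a ν (k, l) * ε ν (k, l) ^ m)
      have e : a ν (i, i') * ε ν (i, i') ^ m + a ν (i, j') * ε ν (i, j') ^ m + a ν (j, i') * ε ν (j, i') ^ m
          + a ν (j, j') * ε ν (j, j') ^ m + a ν (k, l) * ε ν (k, l) ^ m - a ν (k, l) * ε ν (k, l) ^ m
          = a ν (i, i') * ε ν (i, i') ^ m + a ν (i, j') * ε ν (i, j') ^ m + a ν (j, i') * ε ν (j, i') ^ m
          + a ν (j, j') * ε ν (j, j') ^ m := by ring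
      rw [e] at this
      linarith
    have m1 := hlow 1 (by simp); have m2 := hlow 2 (by simp); have m3 := hlow 3 (by simp)
    simp only [pow_one] at m1
    have hwν := hw0 ν
    have hw2 : w ν ^ 2 ≤ w ν := by nlinarith
    have hw3 : w ν ^ 3 ≤ w ν := by nlinarith
    have hw4 : w ν ^ 4 ≤ w ν := by nlinarith
    have hpos : 0 ≤ (1 + C'') * μ ν := mul_nonneg (by linarith) hμ'.le
    have hcross : |a ν (i, i') * ε ν (i, i') ^ 4 + a ν (i, j') * ε ν (i, j') ^ 4 + a ν (j, i') * ε ν (j, i') ^ 4 + a ν (j, j') * ε ν (j, j') ^ 4|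
        ≤ 15 * (1 + C'' + C') * w ν * μ ν := by
      have hA' := hA ν
      have t1 : 4 * w ν * |a ν (i, i') * ε ν (i, i') ^ 3 + a ν (i, j') * ε ν (i, j') ^ 3 + a ν (j, i') * ε ν (j, i') ^ 3 + a ν (j, j') * ε ν (j, j') ^ 3|
          ≤ 4 * w ν * ((1 + C'') * μ ν) := mul_le_mul_of_nonneg_left m3 (by linarith)
      have t2 : 6 * w ν ^ 2 * |a ν (i, i') * ε ν (i, i') ^ 2 + a ν (i, j') * ε ν (i, j') ^ 2 + a ν (j, i') * ε ν (j, i') ^ 2 + a ν (j, j') * ε ν (j, j') ^ 2|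
          ≤ 6 * w ν * ((1 + C'') * μ ν) := by
        calc _ ≤ 6 * w ν ^ 2 * ((1 + C'') * μ ν) := mul_le_mul_of_nonneg_left m2 (by positivity)
          _ ≤ 6 * w ν * ((1 + C'') * μ ν) := by nlinarith
      have t3 : 4 * w ν ^ 3 * |a ν (i, i') * ε ν (i, i') + a ν (i, j') * ε ν (i, j') + a ν (j, i') * ε ν (j, i') + a ν (j, j') * ε ν (j, j')|
          ≤ 4 * w ν * ((1 + C'') * μ ν) := by
        calc _ ≤ 4 * w ν ^ 3 * ((1 + C'') * μ ν) := mul_le_mul_of_nonneg_left m1 (by positivity)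
          _ ≤ 4 * w ν * ((1 + C'') * μ ν) := by nlinarith
      have t4 : w ν ^ 4 * |a ν (i, i') + a ν (i, j') + a ν (j, i') + a ν (j, j')| ≤ w ν * (C' * μ ν) := by
        calc _ ≤ w ν ^ 4 * (C' * μ ν) := mul_le_mul_of_nonneg_left hA' (by positivity)
          _ ≤ w ν * (C' * μ ν) := by nlinarith [mul_nonneg hC'0 hμ'.le]
      nlinarith [hrec, t1, t2, t3, t4, mul_nonneg hC'0 hμ'.le, hμ'.le, hwν]
    have hlast : |a ν (k, l) * ε ν (k, l) ^ 4| ≤ C'' * w ν * μ ν := by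
      rw [abs_mul, abs_pow]
      have h1 : |ε ν (k, l)| ^ 4 ≤ w ν := (pow_le_pow_left₀ (abs_nonneg _) (hε ν _) 4).trans hw4
      calc |a ν (k, l)| * |ε ν (k, l)| ^ 4 ≤ C'' * μ ν * w ν := mul_le_mul (hKL ν) h1 (pow_nonneg (abs_nonneg _) _) (mul_nonneg hC''0 hμ'.le)
        _ = C'' * w ν * μ ν := by ring
    have := abs_add_le (a ν (i, i') * ε ν (i, i') ^ 4 + a ν (i, j') * ε ν (i, j') ^ 4 + a ν (j, i') * ε ν (j, i') ^ 4
      + a ν (j, j') * ε ν (j, j') ^ 4) (a ν (k, l) * ε ν (k, l) ^ 4)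
    nlinarith [this, hcross, hlast]
  have hlim : Tendsto (fun ν => (15 * (1 + C'' + C') + C'') * w ν) atTop (𝓝 0) := by
    simpa using hwlim.const_mul (15 * (1 + C'' + C') + C'')
  exact squeeze_zero_norm' (hbound.mono fun ν h => by rw [Real.norm_eq_abs]; exact h) hlim

end Summit.ValiantsHypothesis.ValiantsHypothesis.Theorems.LacunarySymmetroidMatrixDescartes.WallBubbling.SecondOrder
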